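import Mathlib.GroupTheory.SpecificGroups.Quaternion
import Summits.MatrixMultiplication.OmegaCensus.C2QuaternionLaw
import Summits.MatrixMultiplication.OmegaCensus.DihedralLikeLawGap12
import HarnessLib

/-!
# `β(C₂ × Q_{4m})` for `m ≡ 4 (mod 6)`: the window closes to `{law − 8, law − 4}`, and to `law − 8` off two residues

ω-census, family (b3).  Framing: lottery ticket; floor = certified bounds/negative ranges.

`C₂ × Q_{4m} = Multiplicative (ZMod 2) × QuaternionGroup m = G(ℤ₂ × ℤ_{2m}, (0, m))`, `|A| = 4m`.  For `m ≡ 4 (mod 6)`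
(`|A| ≡ 1 (mod 3)`, mod-one law `(32m − 8)/3`) the census knew (`c2_quaternion_window_mod_six_four`):
`(32m − 32)/3 = 16⌊2m/3⌋ ≤ β ≤ (32m − 14)/3` with the law not attained (H′) — a window of seven values.

**Here** (`m ≥ 13`; `A/⟨c₀⟩ = ℤ₂ × ℤ_m` is not cyclic for `m` even, so `DihedralLikeLawGap12.lean` applies):
* `c2_quaternion_volume_mod_six_four`: every TPP triple has `3|S||T||U| + 32 ≤ 32m` (volume `≤ law − 8`) or
  `3|S||T||U| + 20 = 32m` (volume `law − 4`), the latter only if `m ≡ 4 (mod 9)` or `m ≡ 10 (mod 15)`.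
* `c2_quaternion_law_mod_six_four`: **`β(C₂ × Q_{4m}) = 16⌊2m/3⌋ = (32m − 32)/3` exactly for `m ≡ 4 (mod 6)`,
  `m ≥ 13`, `m ≢ 4 (mod 9)`, `m ≢ 10 (mod 15)`** — i.e. for `m ≡ 16, 28, 34, 46, 52, 64, 82, 88 (mod 90)`
  (`m = 16, 28, 34, 46, 52, 64, 82, 88, 106, …`; `|G| = 16m = 256, 448, 544, …`).
* `c2_quaternion_two_values_mod_six_four`: for every `m ≡ 4 (mod 6)`, `m ≥ 13`:
  `β ∈ {(32m − 32)/3, (32m − 20)/3}`, the lower value attained.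
* `c2_quaternion_sub_four_shape`: a triple of volume `(32m − 20)/3` has, up to the roles of the three sets, coset parts
  `(c+1, c | d,d | e,e)` with `de ∈ {3, 5}` (`4m = 9c + 7` resp. `15c + 10`) — the object a search for the upper value
  must look for (`m = 22, 40, 58, 70, 76, 94, …`).
Not covered: `m = 4` (`β(C₂ × Q₁₆) = 32 = law − 8`, LRAT-checked census datum) and `m = 10` (`|A| = 40 < 52`: the
sporadic vertex pattern `(1,1 | 3,4 | 3,4)` of volume `98 = law − 6` survives counting; `β(C₂ × Q₄₀) ∈ {96, 98, 100}`).
-/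

namespace Summit.MatrixMultiplication.OmegaCensus

open Literature.Combinatorics.Additive Finset

section C2Q

variable {m : ℕ} [NeZero m]

/-- In `A = ℤ₂ × ℤ_{2m}` with `m` even, `c₀ = (0, m)` is non-zero and `A/⟨c₀⟩` is not cyclic (no `g` with
`A = ⟨g⟩ ∪ (c₀ + ⟨g⟩)`): `c₀ = 2·(0, m/2)` is a double and `A` itself is not cyclic. [folklore] -/
theorem z2_z2m_quot_half_noncyclic [NeZero (2 * m)] (hm2 : 2 ∣ m) :
    (((0 : ZMod 2), (m : ZMod (2 * m))) : ZMod 2 × ZMod (2 * m)) ≠ 0 ∧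
    ¬ ∃ g : ZMod 2 × ZMod (2 * m), ∀ x, x ∈ AddSubgroup.zmultiples g ∨
      x + ((0 : ZMod 2), (m : ZMod (2 * m))) ∈ AddSubgroup.zmultiples g := by
  have hm0 : m ≠ 0 := NeZero.ne m
  have hc₀ : (((0 : ZMod 2), (m : ZMod (2 * m))) : ZMod 2 × ZMod (2 * m)) ≠ 0 := by
    intro h0
    have h1 : (m : ZMod (2 * m)) = 0 := congrArg Prod.snd h0
    rw [ZMod.natCast_eq_zero_iff] at h1
    have := Nat.le_of_dvd (Nat.pos_of_ne_zero hm0) h1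
    omega
  refine ⟨hc₀, ?_⟩
  have ha : (((0 : ZMod 2), ((m / 2 : ℕ) : ZMod (2 * m))) : ZMod 2 × ZMod (2 * m)) + (0, ((m / 2 : ℕ) : ZMod (2 * m))) =
      ((0 : ZMod 2), (m : ZMod (2 * m))) := by
    refine Prod.ext (by simp) ?_
    show ((m / 2 : ℕ) : ZMod (2 * m)) + ((m / 2 : ℕ) : ZMod (2 * m)) = (m : ZMod (2 * m))
    rw [← Nat.cast_add]; congr 1; omega
  have h2c : (((0 : ZMod 2), (m : ZMod (2 * m))) : ZMod 2 × ZMod (2 * m)) + (0, (m : ZMod (2 * m))) = 0 := by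
    refine Prod.ext (by simp) ?_
    show (m : ZMod (2 * m)) + (m : ZMod (2 * m)) = 0
    rw [← Nat.cast_add, ZMod.natCast_eq_zero_iff]; exact ⟨1, by ring⟩
  rintro ⟨g, hg⟩
  exact not_cyclic_zmod_two_prod (k := 2 * m) (dvd_mul_right 2 m) ⟨g, cyclic_of_quot_cyclic_of_double ha h2c hg⟩

/-- **`m ≡ 4 (mod 6)`, `m ≥ 13`: every TPP triple of `C₂ × Q_{4m}` has volume `≤ law − 8 = (32m − 32)/3`, or exactly
`law − 4 = (32m − 20)/3` and then `m ≡ 4 (mod 9)` or `m ≡ 10 (mod 15)`.** [folklore] -/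
theorem c2_quaternion_volume_mod_six_four (hmod : m % 6 = 4) (hm : 13 ≤ m)
    {S T U : Finset (Multiplicative (ZMod 2) × QuaternionGroup m)} (h : TripleProductProperty S T U) :
    3 * (S.card * T.card * U.card) + 32 ≤ 32 * m ∨
      (3 * (S.card * T.card * U.card) + 20 = 32 * m ∧ (m % 9 = 4 ∨ m % 15 = 10)) := by
  haveI : NeZero (2 * m) := ⟨by omega⟩
  obtain ⟨hc₀, hnq⟩ := z2_z2m_quot_half_noncyclic (m := m) ⟨m / 2, by omega⟩
  refine c2_quaternion_presentation (m := m) fun ρ τ c₀ hρρ hρτ hτρ hττ hρ hτ hne hsurj hc => ?_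
  subst hc
  have hcard : Fintype.card (ZMod 2 × ZMod (2 * m)) = 4 * m := by
    rw [Fintype.card_prod, ZMod.card, ZMod.card]; ring
  have key := tpp_volume_dicyclic_quot_noncyclic hρρ hρτ hτρ hττ hc₀ hnq hρ hτ hne hsurj (by rw [hcard]; omega)
    (by rw [hcard]; omega) h
  rw [hcard] at key
  omega

/-- **`β(C₂ × Q_{4m}) = 16⌊2m/3⌋ = (32m − 32)/3` exactly for `m ≡ 4 (mod 6)`, `m ≥ 13`, `m ≢ 4 (mod 9)`,
`m ≢ 10 (mod 15)`** (both halves kernel; the lower bound is `c2_quaternion_volume_ge`). [folklore] -/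
theorem c2_quaternion_law_mod_six_four (hmod : m % 6 = 4) (hm : 13 ≤ m) (h9 : m % 9 ≠ 4) (h15 : m % 15 ≠ 10) :
    (∀ S T U : Finset (Multiplicative (ZMod 2) × QuaternionGroup m), TripleProductProperty S T U →
        S.card * T.card * U.card ≤ 16 * (2 * m / 3)) ∧
    ∃ S T U : Finset (Multiplicative (ZMod 2) × QuaternionGroup m), TripleProductProperty S T U ∧
      S.card * T.card * U.card = 16 * (2 * m / 3) := by
  refine ⟨fun S T U h => ?_, c2_quaternion_volume_ge (by omega)⟩
  rcases c2_quaternion_volume_mod_six_four hmod hm h with h32 | ⟨-, hres⟩ <;> omega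

/-- **Every `m ≡ 4 (mod 6)`, `m ≥ 13`: `β(C₂ × Q_{4m}) ∈ {(32m − 32)/3, (32m − 20)/3}`** — each TPP triple has
`3|S||T||U| + 32 ≤ 32m` or `3|S||T||U| + 20 = 32m`, and `3|S||T||U| + 32 = 32m` is attained. [folklore] -/
theorem c2_quaternion_two_values_mod_six_four (hmod : m % 6 = 4) (hm : 13 ≤ m) :
    (∀ S T U : Finset (Multiplicative (ZMod 2) × QuaternionGroup m), TripleProductProperty S T U →
        3 * (S.card * T.card * U.card) + 32 ≤ 32 * m ∨ 3 * (S.card * T.card * U.card) + 20 = 32 * m) ∧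
    ∃ S T U : Finset (Multiplicative (ZMod 2) × QuaternionGroup m), TripleProductProperty S T U ∧
      3 * (S.card * T.card * U.card) + 32 = 32 * m := by
  refine ⟨fun S T U h => ?_, ?_⟩
  · rcases c2_quaternion_volume_mod_six_four hmod hm h with h32 | ⟨h20, -⟩
    · exact Or.inl h32
    · exact Or.inr h20
  · obtain ⟨S, T, U, h, hV⟩ := c2_quaternion_volume_ge (m := m) (by omega)
    exact ⟨S, T, U, h, by rw [hV]; omega⟩

/-- **The `law − 4` triples of `C₂ × Q_{4m}` have shape P3 or P5** (`m ≡ 4 (mod 6)`, `m ≥ 13`): in any dihedral-like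
coordinates `ρ, τ` over `ℤ₂ × ℤ_{2m}` with `c₀ = (0, m)`, a TPP triple with `3|S||T||U| + 20 = 32m` has, up to the roles
of the three sets, coset parts `(c+1, c | d,d | e,e)` with `de ∈ {3, 5}`. [folklore] -/
theorem c2_quaternion_sub_four_shape (hmod : m % 6 = 4) (hm : 13 ≤ m)
    {G : Type} [Group G] [DecidableEq G] {ρ τ : ZMod 2 × ZMod (2 * m) → G}
    (hρρ : ∀ a b, ρ a * ρ b = ρ (a + b)) (hρτ : ∀ a b, ρ a * τ b = τ (b - a))
    (hτρ : ∀ a b, τ a * ρ b = τ (a + b))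
    (hττ : ∀ a b, τ a * τ b = ρ ((((0 : ZMod 2), (m : ZMod (2 * m))) : ZMod 2 × ZMod (2 * m)) + b - a))
    (hρ : Function.Injective ρ) (hτ : Function.Injective τ) (hne : ∀ a b, ρ a ≠ τ b)
    (hsurj : ∀ g, (∃ a, ρ a = g) ∨ (∃ a, τ a = g))
    {S T U : Finset G} (h : TripleProductProperty S T U) (hV : 3 * (S.card * T.card * U.card) + 20 = 32 * m) :
    let s₀ := (univ.filter fun a : ZMod 2 × ZMod (2 * m) => ρ a ∈ S).card
    let s₁ := (univ.filter fun a : ZMod 2 × ZMod (2 * m) => τ a ∈ S).card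
    let t₀ := (univ.filter fun a : ZMod 2 × ZMod (2 * m) => ρ a ∈ T).card
    let t₁ := (univ.filter fun a : ZMod 2 × ZMod (2 * m) => τ a ∈ T).card
    let u₀ := (univ.filter fun a : ZMod 2 × ZMod (2 * m) => ρ a ∈ U).card
    let u₁ := (univ.filter fun a : ZMod 2 × ZMod (2 * m) => τ a ∈ U).card
    (t₀ = t₁ ∧ u₀ = u₁ ∧ (t₀ * u₀ = 3 ∨ t₀ * u₀ = 5) ∧ (s₀ = s₁ + 1 ∨ s₁ = s₀ + 1)) ∨
    (s₀ = s₁ ∧ u₀ = u₁ ∧ (s₀ * u₀ = 3 ∨ s₀ * u₀ = 5) ∧ (t₀ = t₁ + 1 ∨ t₁ = t₀ + 1)) ∨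
    (s₀ = s₁ ∧ t₀ = t₁ ∧ (s₀ * t₀ = 3 ∨ s₀ * t₀ = 5) ∧ (u₀ = u₁ + 1 ∨ u₁ = u₀ + 1)) := by
  haveI : NeZero (2 * m) := ⟨by omega⟩
  obtain ⟨hc₀, hnq⟩ := z2_z2m_quot_half_noncyclic (m := m) ⟨m / 2, by omega⟩
  have hcard : Fintype.card (ZMod 2 × ZMod (2 * m)) = 4 * m := by
    rw [Fintype.card_prod, ZMod.card, ZMod.card]; ring
  exact sub_four_shape_of_quot_noncyclic hρρ hρτ hτρ hττ hc₀ hnq hρ hτ hne hsurj (by rw [hcard]; omega)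
    (by rw [hcard]; omega) h (by rw [hcard]; omega)

end C2Q

end Summit.MatrixMultiplication.OmegaCensus
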